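import Summits.QuantumFields.YangMills.Theorems.LangevinControlUVOSLegsFromFemtoAndGapStubAssemblyRPLimit
import Summits.QuantumFields.YangMills.Theorems.PencilRigidityHypercubicLimitRpBlockMomentTheta
import HarnessLib

/-!
# Soft OS-assembly toolkit XXIV-a: the time-reflection defect of the centred density distributions

Helper file for stub `stub_hypercubic` of crux `OSLegsFromFemtoAndGap` (stmt-QuantumFields-9367, line
`dlr-collar-transfer`, reshape r3).  The time reflection `Θ = thetaMulti 4` (`θ x = (−x⁰, x⃗)`) is an exact
symmetry of the lattice only up to one-step shifts: the torus Wilson state is invariant under the bond reflection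
`t ↦ 1 − t` of the odd torus (tree block `rpBlock_momentTheta`), under which the plane-string weights obey
`W^q(θ̃_q x) = W^q(x)` with the ORIENTATION-DEPENDENT reflected sites `θ̃_q x = θ_ℤ x − [q temporal] e₀`
(`torusMomentStr_plane_thetaSite`), and `θ(a x) = a θ̃_q x − a (1 − [q temporal]) e₀`.  Reindexing the box sum by
the involution `θ̃` therefore turns `W^q ⋆ (ΘF) − W^q ⋆ F` into a shift defect `Σₓ W^q(x) (F(a x + c) − F(a x))`
with `‖c_l‖ ≤ a` plus two wrap-around sums over multi-sites with a coordinate of size `≥ L`, killed by the Schwartz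
decay of `F` at distance `≈ a L ≥ a⁻¹` exactly as in toolkit VIII-a (`norm_sum_thetaMulti_sub_le`).  Summing over
the `6ⁿ` plane strings: **`norm_latticeDist_dens_thetaMulti_sub_le`**, an `O(a)` bound given the shift-defect bound
of the soft bundle.
-/

noncomputable section

open scoped SchwartzMap BigOperators
open MeasureTheory Filter Topology
open Literature.MathematicalPhysics.QuantumFieldTheory Literature.MathematicalPhysics.QuantumLattice
open Literature.MathematicalPhysics.AQFT
open Literature.Probability.LatticeModels (box Site mem_box)
open Summit.QuantumFields.YangMills.Cruxes.OSLegsFromFemtoAndGap.DlrCollarTransfer (plane)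
open Summit.QuantumFields.YangMills.Theorems.HypercubicLimit.Negative (torusPlaquette thetaZ)
open Summit.QuantumFields.YangMills.Cruxes.HypercubicLimit.ConditionalMeanTelescoping (rpBlock_momentTheta)

namespace Summit.QuantumFields.YangMills.Theorems.OSLegsFromFemtoAndGap


/-! ### The reflected sites and the reflection invariance of the plane-string weights -/

/-- `θ̃_q x` in the tree's form: `θ_ℤ x − e₀` for temporal `q`, `θ_ℤ x` for spatial `q`. -/
theorem thetaSite_eq_ite (q : Fin 4 × Fin 4) (x : Site 4) :
    thetaSite q x = if q.1 = 0 then thetaZ x - Pi.single 0 1 else thetaZ x := by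
  unfold thetaSite
  split_ifs <;> simp

/-- `θ(a x) = a θ̃_q x − a (1 − [q temporal]) e₀`. -/
theorem timeReflection_smul_siteToE (a : ℝ) (q : Fin 4 × Fin 4) (x : Site 4) :
    timeReflection 4 (a • siteToE x) = a • siteToE (thetaSite q x) +
      (-(a * (1 - if q.1 = 0 then 1 else 0))) • siteToE (Pi.single (0 : Fin 4) (1 : ℤ)) := by
  rw [smul_siteToE_thetaSite, neg_smul, add_neg_cancel_right]

/-- The one-step shift has norm at most `a`. -/
theorem norm_thetaShift_le {a : ℝ} (ha : 0 < a) (q : Fin 4 × Fin 4) :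
    ‖(-(a * (1 - if q.1 = 0 then 1 else 0))) • siteToE (Pi.single (0 : Fin 4) (1 : ℤ))‖ ≤ a := by
  rw [norm_smul, norm_siteToE_single, mul_one, norm_neg, Real.norm_eq_abs]
  split_ifs <;> simp [abs_of_pos ha, ha.le]

/-- Outside `(box L)ⁿ` some coordinate of some site exceeds `L` in absolute value. -/
theorem exists_abs_gt_of_not_mem_piFinset_box {n L : ℕ} {y : Fin n → Site 4}
    (hy : y ∉ Fintype.piFinset (fun _ : Fin n => box 4 L)) : ∃ i k, (L : ℤ) < |y i k| := by
  simp only [Fintype.mem_piFinset, not_forall] at hy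
  obtain ⟨i, hi⟩ := hy
  rw [mem_box, not_forall] at hi
  obtain ⟨k, hk⟩ := hi
  refine ⟨i, k, ?_⟩
  rw [lt_abs]
  omega

variable {G : Type} [Group G] [TopologicalSpace G] [IsTopologicalGroup G] [CompactSpace G]
  [MeasurableSpace G] [BorelSpace G]

/-- **Reflection invariance of the plane-string weights**: `W^q(θ̃_q x) = W^q(x)` for valid orientations `q`
(pointwise reflection law of the torus plaquettes and `Θ`-invariance of Wilson's torus state, tree block
`rpBlock_momentTheta`). -/
theorem torusMomentStr_plane_thetaSite (r : LatticeRep G) (β : ℝ) (L : ℕ) {n : ℕ} {q : Fin n → Fin 4 × Fin 4}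
    (hq : ∀ i, (q i).1 < (q i).2) (m : Fin n → ℝ) (x : Fin n → Site 4) :
    torusMomentStr r.ρ β L (fun i U => plaquetteObs r.ρ 0 (q i).1 (q i).2 U) m (fun i => thetaSite (q i) (x i)) =
      torusMomentStr r.ρ β L (fun i U => plaquetteObs r.ρ 0 (q i).1 (q i).2 U) m x := by
  unfold torusMomentStr
  have hl : ∀ (i : Fin n) (z : Site 4) (U : GaugeConfig 4 (2 * L + 1) G),
      plaquetteObs r.ρ 0 (q i).1 (q i).2 (configShift (-z) (torusLift (2 * L + 1) U)) =
        torusPlaquette r (2 * L + 1) (q i).1 (q i).2 z U := fun i z U => plane_torusLift r _ (q i) z U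
  simp_rw [hl, thetaSite_eq_ite]
  exact (rpBlock_momentTheta G r β L n q m x hq).symm

/-! ### The reflection defect of one weighted box sum -/

/-- **The time-reflection defect of a weighted box sum.**  For weights `W` on `n`-multi-sites bounded by `Mⁿ`
and invariant under the reflected sites `θ̃_q` of a string `q`, spacing `a > 0` and a box of half-side
`L ≥ 2`, `L ≥ a⁻²`: `‖Σₓ W(x) (ΘF)(a x) − Σₓ W(x) F(a x)‖ ≤ 2·3⁴ⁿ·2^{8n+1}·Mⁿ·‖F‖_{8n+1,0}·a + D`, where `D`
bounds the shift defect `‖Σₓ W(x) (F(a x + c) − F(a x))‖` at the one-step shift `c_l = −a(1 − [q l temporal]) e₀`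
(the rest are the two wrap-around sums over multi-sites with a coordinate `≥ L`, Schwartz decay at `a L/2`). -/
theorem norm_sum_thetaMulti_sub_le {n : ℕ} (q : Fin n → Fin 4 × Fin 4) (W : (Fin n → Site 4) → ℂ) {M : ℝ}
    (hM : 0 ≤ M) (hWb : ∀ x, ‖W x‖ ≤ M ^ n) (hWθ : ∀ x, W (fun l => thetaSite (q l) (x l)) = W x)
    {a : ℝ} (ha : 0 < a) {L : ℕ} (hL2 : 2 ≤ L) (hLa : a⁻¹ * a⁻¹ ≤ L)
    (F : 𝓢((Fin n → (EuclideanSpace ℝ (Fin 4))), ℂ))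
    {D : ℝ}
    (hdef : ‖∑ x ∈ Fintype.piFinset (fun _ : Fin n => box 4 L), W x *
        (F ((fun l => a • siteToE (x l)) +
            fun l => (-(a * (1 - if (q l).1 = 0 then 1 else 0))) • siteToE (Pi.single (0 : Fin 4) (1 : ℤ))) -
          F (fun l => a • siteToE (x l)))‖ ≤ D) :
    ‖∑ x ∈ Fintype.piFinset (fun _ : Fin n => box 4 L), W x * thetaMulti 4 F (fun l => a • siteToE (x l)) -
        ∑ x ∈ Fintype.piFinset (fun _ : Fin n => box 4 L), W x * F (fun l => a • siteToE (x l))‖ ≤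
      2 * 3 ^ (4 * n) * 2 ^ (8 * n + 1) * M ^ n * SchwartzMap.seminorm ℂ (8 * n + 1) 0 F * a + D := by
  classical
  -- the shift, the involution `θ̃`, the two index sets and the summand
  set c : Fin n → (EuclideanSpace ℝ (Fin 4)) := fun l => (-(a * (1 - if (q l).1 = 0 then 1 else 0))) •
    siteToE (Pi.single (0 : Fin 4) (1 : ℤ)) with hc
  have hinv : Function.Involutive (fun x : Fin n → Site 4 => fun l => thetaSite (q l) (x l)) := fun x =>
    funext fun l => thetaSite_thetaSite (q l) (x l)
  set S₁ : Finset (Fin n → Site 4) := Fintype.piFinset (fun _ : Fin n => box 4 L) with hS₁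
  set S₂ : Finset (Fin n → Site 4) := S₁.map (hinv.toPerm _).toEmbedding with hS₂
  set g : (Fin n → Site 4) → ℂ := fun y => W y * F ((fun l => a • siteToE (y l)) + c) with hg
  -- Step 1: the reflected sum is the shifted sum over the reflected index set
  have h1 : ∑ x ∈ S₁, W x * thetaMulti 4 F (fun l => a • siteToE (x l)) = ∑ y ∈ S₂, g y := by
    rw [hS₂, Finset.sum_map]
    refine Finset.sum_congr rfl fun x _ => ?_
    simp only [hg, Equiv.coe_toEmbedding, Function.Involutive.coe_toPerm, thetaMulti_apply]
    rw [hWθ x]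
    congr 2
    funext l
    rw [Pi.add_apply, hc]
    exact timeReflection_smul_siteToE a (q l) (x l)
  -- Step 2: the unreflected sum is the shifted sum minus the shift defect
  have h2 : ∑ x ∈ S₁, W x * F (fun l => a • siteToE (x l)) =
      ∑ y ∈ S₁, g y - ∑ x ∈ S₁, W x * (F ((fun l => a • siteToE (x l)) + c) - F (fun l => a • siteToE (x l))) := by
    rw [← Finset.sum_sub_distrib]
    refine Finset.sum_congr rfl fun x _ => ?_
    rw [hg]
    ring
  -- Step 3: sizes
  have hL1 : (1 : ℝ) ≤ L := by exact_mod_cast (show 1 ≤ L by omega)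
  have haaL : (1 : ℝ) ≤ a * a * L := by
    have := mul_le_mul_of_nonneg_left hLa (show (0 : ℝ) ≤ a * a by positivity)
    rwa [show a * a * (a⁻¹ * a⁻¹) = 1 by field_simp] at this
  set t : ℝ := a * L / 2 with ht
  have htpos : 0 < t := by positivity
  set B : ℝ := M ^ n * (SchwartzMap.seminorm ℂ (8 * n + 1) 0 F / t ^ (8 * n + 1)) with hB
  have hcl : ∀ l, ‖c l‖ ≤ a := fun l => by rw [hc]; exact norm_thetaShift_le ha (q l)
  -- Step 4: per-term bound in the wrap zone
  have hterm : ∀ y : Fin n → Site 4, (∃ i k, (L : ℤ) ≤ |y i k|) → ‖g y‖ ≤ B := by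
    rintro y ⟨i, k, hik⟩
    rw [hg]
    dsimp only
    rw [norm_mul, hB]
    refine mul_le_mul (hWb y) ?_ (norm_nonneg _) (pow_nonneg hM n)
    refine norm_apply_le_seminorm_div F (8 * n + 1) htpos i ?_
    rw [Pi.add_apply]
    have h1' : (L : ℝ) ≤ ‖y i‖ := by
      have hk' : ((L : ℤ) : ℝ) ≤ ((|y i k| : ℤ) : ℝ) := by exact_mod_cast hik
      rw [Int.cast_abs, Int.cast_natCast] at hk'
      exact hk'.trans ((Int.norm_eq_abs (y i k)).symm.le.trans (norm_le_pi_norm (y i) k))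
    have h2' : a * ‖y i‖ ≤ ‖a • siteToE (y i)‖ := mul_norm_le_norm_smul_siteToE ha.le (y i)
    have h3' : ‖a • siteToE (y i)‖ ≤ ‖a • siteToE (y i) + c i‖ + ‖c i‖ := by
      have := norm_add_le (a • siteToE (y i) + c i) (-c i)
      rwa [add_neg_cancel_right, norm_neg] at this
    have h4' := hcl i
    have h5' : a * 2 ≤ a * L := mul_le_mul_of_nonneg_left (by exact_mod_cast hL2) ha.le
    have h6' : a * L ≤ a * ‖y i‖ := mul_le_mul_of_nonneg_left h1' ha.le
    rw [ht]
    linarith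
  -- Step 5: both wrap zones consist of multi-sites with a coordinate `≥ L`
  have hA : ∀ y ∈ S₂ \ S₁, ∃ i k, (L : ℤ) ≤ |y i k| := by
    intro y hy
    rw [Finset.mem_sdiff] at hy
    obtain ⟨i, k, h⟩ := exists_abs_gt_of_not_mem_piFinset_box hy.2
    exact ⟨i, k, h.le⟩
  have hBset : ∀ y ∈ S₁ \ S₂, ∃ i k, (L : ℤ) ≤ |y i k| := by
    intro y hy
    rw [Finset.mem_sdiff] at hy
    have hy2 : (fun l => thetaSite (q l) (y l)) ∉ S₁ := by
      intro h
      apply hy.2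
      rw [hS₂, Finset.mem_map_equiv, Function.Involutive.toPerm_symm, Function.Involutive.coe_toPerm]
      exact h
    obtain ⟨i, k, h⟩ := exists_abs_gt_of_not_mem_piFinset_box hy2
    have h : (L : ℤ) < |thetaSite (q i) (y i) k| := h
    refine ⟨i, k, ?_⟩
    by_cases hk : k = 0
    · subst hk
      rw [thetaSite_apply_zero, lt_abs] at h
      rw [le_abs]
      split_ifs at h <;> omega
    · rw [thetaSite_apply_of_ne _ _ hk] at h
      exact h.le
  -- Step 6: sum the bounds
  have hcard₁ : (S₁.card : ℝ) = ((2 * L + 1 : ℕ) : ℝ) ^ (4 * n) := by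
    rw [hS₁, Fintype.card_piFinset, Finset.prod_const, Finset.card_univ, Fintype.card_fin,
      Literature.Probability.LatticeModels.card_box, ← pow_mul]
    push_cast
    ring
  have hcard₂ : (S₂.card : ℝ) = ((2 * L + 1 : ℕ) : ℝ) ^ (4 * n) := by
    rw [hS₂, Finset.card_map, hcard₁]
  have hB0 : 0 ≤ B := by positivity
  have hsum₁ : ‖∑ y ∈ S₂ \ S₁, g y‖ ≤ ((2 * L + 1 : ℕ) : ℝ) ^ (4 * n) * B := by
    calc ‖∑ y ∈ S₂ \ S₁, g y‖ ≤ ∑ y ∈ S₂ \ S₁, ‖g y‖ := norm_sum_le _ _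
      _ ≤ ∑ _y ∈ S₂ \ S₁, B := Finset.sum_le_sum fun y hy => hterm y (hA y hy)
      _ = ((S₂ \ S₁).card : ℝ) * B := by rw [Finset.sum_const, nsmul_eq_mul]
      _ ≤ (S₂.card : ℝ) * B := by gcongr; exact Finset.sdiff_subset
      _ = _ := by rw [hcard₂]
  have hsum₂ : ‖∑ y ∈ S₁ \ S₂, g y‖ ≤ ((2 * L + 1 : ℕ) : ℝ) ^ (4 * n) * B := by
    calc ‖∑ y ∈ S₁ \ S₂, g y‖ ≤ ∑ y ∈ S₁ \ S₂, ‖g y‖ := norm_sum_le _ _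
      _ ≤ ∑ _y ∈ S₁ \ S₂, B := Finset.sum_le_sum fun y hy => hterm y (hBset y hy)
      _ = ((S₁ \ S₂).card : ℝ) * B := by rw [Finset.sum_const, nsmul_eq_mul]
      _ ≤ (S₁.card : ℝ) * B := by gcongr; exact Finset.sdiff_subset
      _ = _ := by rw [hcard₁]
  -- Step 7: the arithmetic `(2L+1)^{4n} / t^{8n+1} ≤ 3^{4n} 2^{8n+1} a`
  have key : ((2 * L + 1 : ℕ) : ℝ) ^ (4 * n) ≤ 3 ^ (4 * n) * a * (a * L) ^ (8 * n + 1) := by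
    have h3 : ((2 * L + 1 : ℕ) : ℝ) ≤ 3 * L := by push_cast; linarith
    calc ((2 * L + 1 : ℕ) : ℝ) ^ (4 * n) ≤ (3 * (L : ℝ)) ^ (4 * n) := pow_le_pow_left₀ (by positivity) h3 _
      _ = 3 ^ (4 * n) * (L : ℝ) ^ (4 * n) := mul_pow _ _ _
      _ ≤ 3 ^ (4 * n) * (L : ℝ) ^ (4 * n) * (a * a * L) ^ (4 * n + 1) :=
          le_mul_of_one_le_right (by positivity) (one_le_pow₀ haaL)
      _ = 3 ^ (4 * n) * a * (a * L) ^ (8 * n + 1) := by ring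
  have hfinal : 2 * ((2 * L + 1 : ℕ) : ℝ) ^ (4 * n) * B ≤
      2 * 3 ^ (4 * n) * 2 ^ (8 * n + 1) * M ^ n * SchwartzMap.seminorm ℂ (8 * n + 1) 0 F * a := by
    have htpow : t ^ (8 * n + 1) = (a * L) ^ (8 * n + 1) / 2 ^ (8 * n + 1) := by
      rw [ht, div_pow]
    have haL : 0 < (a * L) ^ (8 * n + 1) := by positivity
    rw [hB, htpow, div_div_eq_mul_div]
    rw [show 2 * ((2 * L + 1 : ℕ) : ℝ) ^ (4 * n) *
        (M ^ n * (SchwartzMap.seminorm ℂ (8 * n + 1) 0 F * 2 ^ (8 * n + 1) / (a * L) ^ (8 * n + 1))) =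
        2 * M ^ n * SchwartzMap.seminorm ℂ (8 * n + 1) 0 F * 2 ^ (8 * n + 1) *
          (((2 * L + 1 : ℕ) : ℝ) ^ (4 * n) / (a * L) ^ (8 * n + 1)) by ring]
    have hq : ((2 * L + 1 : ℕ) : ℝ) ^ (4 * n) / (a * L) ^ (8 * n + 1) ≤ 3 ^ (4 * n) * a := by
      rw [div_le_iff₀ haL]; linarith [key]
    calc 2 * M ^ n * SchwartzMap.seminorm ℂ (8 * n + 1) 0 F * 2 ^ (8 * n + 1) *
          (((2 * L + 1 : ℕ) : ℝ) ^ (4 * n) / (a * L) ^ (8 * n + 1))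
        ≤ 2 * M ^ n * SchwartzMap.seminorm ℂ (8 * n + 1) 0 F * 2 ^ (8 * n + 1) * (3 ^ (4 * n) * a) := by
          gcongr
      _ = _ := by ring
  -- Step 8: assemble
  rw [h1, h2, show ∀ u v w : ℂ, u - (v - w) = u - v + w from fun u v w => by ring,
    ← Finset.sum_sdiff_sub_sum_sdiff]
  have hwrap := norm_sub_le_of_le hsum₁ hsum₂
  have htot := norm_add_le_of_le hwrap hdef
  linarith [htot, hfinal]

/-! ### The reflection defect of the centred density distributions -/

/-- **The time-reflection defect of the centred density distributions is `O(a)`.**  On the torus of half-side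
`L ≥ 2`, `L ≥ a⁻²`, at spacing `a > 0`, given the sup bound `Cₚ` of the plane fields and the shift-defect bound
(constant `K`) for all valid plane strings of length `n` at shifts `‖c_l‖ ≤ a`, for every `F ∈ ⁰𝒮ₙ`:
`‖T(ΘF) − T(F)‖ ≤ 6ⁿ (2·3⁴ⁿ·2^{8n+1} (2Cₚ)ⁿ ‖F‖_{8n+1,0} + 2 Kⁿ Σ⁺(F)) · a` — the density distribution is the sum
of the `6ⁿ` plane-string distributions, each reflection invariant up to the one-step shifts of the reflected
plaquette corners and the wrap-around. -/
theorem norm_latticeDist_dens_thetaMulti_sub_le (r : LatticeRep G) (β : ℝ) (L : ℕ) {a K Cp : ℝ} (ha : 0 < a)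
    (hL2 : 2 ≤ L) (hLa : a⁻¹ * a⁻¹ ≤ L) (hK : 0 ≤ K)
    (hCp : ∀ (q : Fin 4 × Fin 4) (x : Fin 4 → ℤ) (U : LGConfig 4 G), |plane G r q x U| ≤ Cp) {n : ℕ}
    (hdef : ∀ q : Fin n → Fin 4 × Fin 4, (∀ i, (q i).1 < (q i).2) →
      ∀ F : 𝓢((Fin n → (EuclideanSpace ℝ (Fin 4))), ℂ), IsOffDiagonal F →
      ∀ c : Fin n → (EuclideanSpace ℝ (Fin 4)), (∀ l, ‖c l‖ ≤ a) →
        ‖∑ x ∈ Fintype.piFinset (fun _ : Fin n => box 4 L),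
          ((torusMomentStr r.ρ β L (fun i U => plaquetteObs r.ρ 0 (q i).1 (q i).2 U)
            (fun i => wilsonTorusMean r.ρ β L (fun U => plaquetteObs r.ρ 0 (q i).1 (q i).2 U)) x : ℝ) : ℂ) *
            (F ((fun l => a • siteToE (x l)) + c) - F (fun l => a • siteToE (x l)))‖ ≤
          2 * ‖c‖ * K ^ n * (SchwartzMap.seminorm ℂ 0 (4 * n + 1) F + SchwartzMap.seminorm ℂ (6 * n) (4 * n + 1) F +
            SchwartzMap.seminorm ℂ 0 1 F + SchwartzMap.seminorm ℂ (6 * n) 1 F + SchwartzMap.seminorm ℂ (10 * n) 1 F))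
    (F : 𝓢((Fin n → (EuclideanSpace ℝ (Fin 4))), ℂ)) (hF : IsOffDiagonal F) :
    ‖latticeDist r.ρ β L a r.curvature.F (wilsonTorusMean r.ρ β L r.curvature.F) n (thetaMulti 4 F) -
        latticeDist r.ρ β L a r.curvature.F (wilsonTorusMean r.ρ β L r.curvature.F) n F‖ ≤
      6 ^ n * ((2 * 3 ^ (4 * n) * 2 ^ (8 * n + 1) * (Cp + Cp) ^ n * SchwartzMap.seminorm ℂ (8 * n + 1) 0 F +
        2 * K ^ n * (SchwartzMap.seminorm ℂ 0 (4 * n + 1) F + SchwartzMap.seminorm ℂ (6 * n) (4 * n + 1) F +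
          SchwartzMap.seminorm ℂ 0 1 F + SchwartzMap.seminorm ℂ (6 * n) 1 F +
          SchwartzMap.seminorm ℂ (10 * n) 1 F)) * a) := by
  classical
  set P : ℝ := SchwartzMap.seminorm ℂ 0 (4 * n + 1) F + SchwartzMap.seminorm ℂ (6 * n) (4 * n + 1) F +
    SchwartzMap.seminorm ℂ 0 1 F + SchwartzMap.seminorm ℂ (6 * n) 1 F + SchwartzMap.seminorm ℂ (10 * n) 1 F with hP
  have hP0 : 0 ≤ P := by positivity
  have hCp0 : 0 ≤ Cp := le_trans (abs_nonneg _) (hCp (0, 1) 0 (fun _ => 1))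
  have hcardP : ((Fintype.piFinset (fun _ : Fin n => Finset.univ.filter fun p : Fin 4 × Fin 4 => p.1 < p.2)).card : ℝ)
      = 6 ^ n := by
    rw [Fintype.card_piFinset, Finset.prod_const, Finset.card_univ, Fintype.card_fin, card_planes]
    push_cast
    ring
  rw [latticeDist_dens_eq_sum_latticeDistStr, latticeDist_dens_eq_sum_latticeDistStr, ← Finset.sum_sub_distrib]
  refine (norm_sum_le _ _).trans ?_
  calc _ ≤ ∑ _q ∈ Fintype.piFinset (fun _ : Fin n => Finset.univ.filter fun p : Fin 4 × Fin 4 => p.1 < p.2),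
        (2 * 3 ^ (4 * n) * 2 ^ (8 * n + 1) * (Cp + Cp) ^ n * SchwartzMap.seminorm ℂ (8 * n + 1) 0 F +
          2 * K ^ n * P) * a := Finset.sum_le_sum fun q hq => ?_
    _ = _ := by rw [Finset.sum_const, nsmul_eq_mul, hcardP]
  have hq' : ∀ i, (q i).1 < (q i).2 := (mem_planeStrings_iff q).1 hq
  have hWb : ∀ x : Fin n → Site 4,
      ‖((torusMomentStr r.ρ β L (fun i U => plaquetteObs r.ρ 0 (q i).1 (q i).2 U)
        (fun i => wilsonTorusMean r.ρ β L (fun U => plaquetteObs r.ρ 0 (q i).1 (q i).2 U)) x : ℝ) : ℂ)‖ ≤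
        (Cp + Cp) ^ n := fun x => by
    rw [Complex.norm_real, Real.norm_eq_abs]
    exact abs_torusMomentStr_plane_le r hCp β L q x
  have hWθ : ∀ x : Fin n → Site 4,
      ((torusMomentStr r.ρ β L (fun i U => plaquetteObs r.ρ 0 (q i).1 (q i).2 U)
        (fun i => wilsonTorusMean r.ρ β L (fun U => plaquetteObs r.ρ 0 (q i).1 (q i).2 U))
        (fun l => thetaSite (q l) (x l)) : ℝ) : ℂ) =
      ((torusMomentStr r.ρ β L (fun i U => plaquetteObs r.ρ 0 (q i).1 (q i).2 U)
        (fun i => wilsonTorusMean r.ρ β L (fun U => plaquetteObs r.ρ 0 (q i).1 (q i).2 U)) x : ℝ) : ℂ) := fun x => by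
    rw [torusMomentStr_plane_thetaSite r β L hq']
  have hcl : ∀ l : Fin n,
      ‖(-(a * (1 - if (q l).1 = 0 then 1 else 0))) • siteToE (Pi.single (0 : Fin 4) (1 : ℤ))‖ ≤ a := fun l =>
    norm_thetaShift_le ha (q l)
  have hcn : ‖(fun l : Fin n => (-(a * (1 - if (q l).1 = 0 then 1 else 0))) •
      siteToE (Pi.single (0 : Fin 4) (1 : ℤ)))‖ ≤ a := (pi_norm_le_iff_of_nonneg ha.le).2 hcl
  have h := norm_sum_thetaMulti_sub_le q
    (fun x => ((torusMomentStr r.ρ β L (fun i U => plaquetteObs r.ρ 0 (q i).1 (q i).2 U)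
      (fun i => wilsonTorusMean r.ρ β L (fun U => plaquetteObs r.ρ 0 (q i).1 (q i).2 U)) x : ℝ) : ℂ))
    (M := Cp + Cp) (by positivity) hWb hWθ ha hL2 hLa F (hdef q hq' F hF _ hcl)
  rw [latticeDistStr_apply, latticeDistStr_apply]
  refine h.trans ?_
  have hmono : 2 * ‖(fun l : Fin n => (-(a * (1 - if (q l).1 = 0 then 1 else 0))) •
      siteToE (Pi.single (0 : Fin 4) (1 : ℤ)))‖ * K ^ n * P ≤ 2 * a * K ^ n * P := by
    gcongr
  linarith [hmono]

end Summit.QuantumFields.YangMills.Theorems.OSLegsFromFemtoAndGap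

end
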